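import Summits.AtomisticToContinuum.HydrodynamicLimit.Theses.CollisionIsometryCLT
import Literature.MathematicalPhysics.KineticTheory.HardSphereEulerProofs

/-!
# `AprioriBounds` (stmt-AtomisticToContinuum-9519), negative knowledge 3/4: FCC packings — the laws keep mass below close packing

Load-bearing analysis of the crux `CollisionIsometryCLT.AprioriBounds` by the standing disprover
(`Cruxes/AprioriBounds/Disproof.lean`, refuter-cdisprove-stmt-AtomisticToContinuum-9519-0).

The local Gibbs law `localGibbsLaw σ a₀ u₀ θ₀ N Φ` of the `HardSphereEuler` prelude is a probability
measure exactly when the non-overlap set of `N + 1` sphere centres at mutual minimal-image distance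
`≥ hsDiameter σ N = σ(N+1)^{-1/3}` has positive volume (`localGibbsMeasure_univ`), and the ZERO
measure otherwise — in which case every "with probability `→ 0`" clause holds vacuously.  The tree
proves positivity for `σ ≤ 1/2` by a cubic grid (`volume_setOf_lt_euclidDist_pos`).  This file pushes
it to the close-packing threshold along a subsequence: for every `σ⁶ < 2` (`σ³ < √2`) and
`N + 1 = 4m³`, the face-centred cubic (`D₃`) configuration `{k/(2m) : k ∈ (ℤ/2m)³, k₁+k₂+k₃ even}`
has all mutual distances `≥ 1/(√2 m) > σ (4m³)^{-1/3}` (`exists_config_fcc`,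
`exists_config_hsDiameter_lt_fcc`; the separation is `gridPoint_dist_sq_of_even`: two differing
coordinates give `2·(1/(2m))²`, a single differing coordinate has EVEN difference —
`two_div_le_norm_sub_div_unitAddCircle` — and gives `(1/m)²`).  Hence the homogeneous local Gibbs
law (`a₀ = θ₀ = 1`, `u₀ = 0`) has mass one there (`localGibbsLaw_univ_fcc`).  Used by file 4/4
(`WithoutSmallSigma`) to show that component (ii) of the crux is false at every `1 < σ³ < √2`.
-/

noncomputable section

open MeasureTheory Filter Set Topology
open scoped ENNReal

namespace Summit.AtomisticToContinuum.HydrodynamicLimit.Theorems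

namespace AprioriBoundsNegative

open Literature.MathematicalPhysics.KineticTheory Literature.Analysis.FluidPDE

/-- Even residues of an even modulus are `≥ 2/M` apart on the unit circle. -/
theorem two_div_le_norm_sub_div_unitAddCircle {M a b : ℕ} (hM : 0 < M) (hMe : Even M) (ha : a < M)
    (hb : b < M) (hab : a ≠ b) (hpar : a % 2 = b % 2) :
    (2 : ℝ) / M ≤ ‖(((a : ℝ) / M : ℝ) : UnitAddCircle) - (((b : ℝ) / M : ℝ) : UnitAddCircle)‖ := by
  rw [← AddCircle.coe_sub, UnitAddCircle.norm_eq]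
  set r : ℤ := round ((a : ℝ) / M - (b : ℝ) / M) with hr
  have hM' : (0 : ℝ) < M := by exact_mod_cast hM
  have key : (a : ℝ) / M - (b : ℝ) / M - r = (((a : ℤ) - b - r * M : ℤ) : ℝ) / M := by
    push_cast
    field_simp
  have hne : (a : ℤ) - b - r * M ≠ 0 :=
    int_sub_ne_mul (Int.natCast_nonneg a) (by exact_mod_cast ha) (Int.natCast_nonneg b)
      (by exact_mod_cast hb) (by exact_mod_cast hab) r
  have hPM : (2 : ℤ) ∣ r * M := by
    obtain ⟨k, hk⟩ := hMe
    exact ⟨r * k, by rw [hk]; push_cast; ring⟩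
  have hpar' : (a : ℤ) % 2 = (b : ℤ) % 2 := by exact_mod_cast hpar
  have hdvd : (2 : ℤ) ∣ (a : ℤ) - b - r * M := by
    set P : ℤ := r * M with hP
    omega
  have h2 : (2 : ℤ) ≤ |(a : ℤ) - b - r * M| := by
    rw [le_abs]
    omega
  have h2' : (2 : ℝ) ≤ |(((a : ℤ) - b - r * M : ℤ) : ℝ)| := by
    rw [← Int.cast_abs]
    exact_mod_cast h2
  rw [key, abs_div, abs_of_pos hM']
  exact div_le_div_of_nonneg_right h2' hM'.le

/-- **`D₃` separation.** Two distinct points of the `(2m)⁻¹`-grid of `𝕋³` with EVEN coordinate sums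
are at squared minimal-image distance `≥ 1/(2m²)` (distance `≥ 1/(√2 m)`): two differing coordinates
contribute `(1/(2m))²` each; a single differing coordinate has even difference and contributes
`(1/m)²`. -/
theorem gridPoint_dist_sq_of_even {m : ℕ} (hm : 0 < m) {k k' : Fin 3 → Fin (2 * m)} (hkk : k ≠ k')
    (hpk : 2 ∣ ((k 0 : ℕ) + (k 1 : ℕ) + (k 2 : ℕ))) (hpk' : 2 ∣ ((k' 0 : ℕ) + (k' 1 : ℕ) + (k' 2 : ℕ))) :
    (1 : ℝ) / (2 * (m : ℝ) ^ 2) ≤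
      (Torus.euclidDist (gridPoint (2 * m) k) (gridPoint (2 * m) k')) ^ 2 := by
  have hm2 : 0 < 2 * m := by omega
  have hmR : (0 : ℝ) < m := by exact_mod_cast hm
  have hcast : ((2 * m : ℕ) : ℝ) = 2 * (m : ℝ) := by push_cast; ring
  -- the squared distance is the sum of the three squared circle distances
  have hS : (Torus.euclidDist (gridPoint (2 * m) k) (gridPoint (2 * m) k')) ^ 2 =
      ∑ l, ‖gridPoint (2 * m) k l - gridPoint (2 * m) k' l‖ ^ 2 := by
    rw [euclidDist_eq_sqrt, Real.sq_sqrt (Finset.sum_nonneg fun l _ => by positivity)]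
  rw [hS, Fin.sum_univ_three]
  -- per-coordinate lower bounds
  have hb : ∀ l, k l ≠ k' l → 1 / (4 * (m : ℝ) ^ 2) ≤ ‖gridPoint (2 * m) k l - gridPoint (2 * m) k' l‖ ^ 2 := by
    intro l hl
    have h1 := inv_le_norm_sub_div_unitAddCircle hm2 (k l).isLt (k' l).isLt
      (fun e => hl (Fin.ext e))
    rw [gridPoint_apply, gridPoint_apply]
    have h1' : 1 / (2 * (m : ℝ)) ≤ ‖((((k l : ℕ) : ℝ) / ((2 * m : ℕ) : ℝ) : ℝ) : UnitAddCircle) -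
        ((((k' l : ℕ) : ℝ) / ((2 * m : ℕ) : ℝ) : ℝ) : UnitAddCircle)‖ := by
      rw [one_div, ← hcast]; exact h1
    have h0 : (0 : ℝ) ≤ 1 / (2 * m) := by positivity
    calc 1 / (4 * (m : ℝ) ^ 2) = (1 / (2 * (m : ℝ))) ^ 2 := by field_simp; ring
      _ ≤ _ := pow_le_pow_left₀ h0 h1' 2
  have hpb : ∀ l, k l ≠ k' l → ((k l : ℕ) % 2 = (k' l : ℕ) % 2) →
      1 / (m : ℝ) ^ 2 ≤ ‖gridPoint (2 * m) k l - gridPoint (2 * m) k' l‖ ^ 2 := by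
    intro l hl hpar
    have h1 := two_div_le_norm_sub_div_unitAddCircle hm2 (even_two_mul m) (k l).isLt (k' l).isLt
      (fun e => hl (Fin.ext e)) hpar
    rw [gridPoint_apply, gridPoint_apply]
    have h1' : 1 / (m : ℝ) ≤ ‖((((k l : ℕ) : ℝ) / ((2 * m : ℕ) : ℝ) : ℝ) : UnitAddCircle) -
        ((((k' l : ℕ) : ℝ) / ((2 * m : ℕ) : ℝ) : ℝ) : UnitAddCircle)‖ := by
      have : (2 : ℝ) / ((2 * m : ℕ) : ℝ) = 1 / m := by rw [hcast]; field_simp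
      rw [← this]; exact h1
    have h0 : (0 : ℝ) ≤ 1 / m := by positivity
    calc 1 / (m : ℝ) ^ 2 = (1 / (m : ℝ)) ^ 2 := by field_simp
      _ ≤ _ := pow_le_pow_left₀ h0 h1' 2
  have hn0 : (0 : ℝ) ≤ ‖gridPoint (2 * m) k 0 - gridPoint (2 * m) k' 0‖ ^ 2 := by positivity
  have hn1 : (0 : ℝ) ≤ ‖gridPoint (2 * m) k 1 - gridPoint (2 * m) k' 1‖ ^ 2 := by positivity
  have hn2 : (0 : ℝ) ≤ ‖gridPoint (2 * m) k 2 - gridPoint (2 * m) k' 2‖ ^ 2 := by positivity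
  have hq : 1 / (2 * (m : ℝ) ^ 2) = 1 / (4 * (m : ℝ) ^ 2) + 1 / (4 * (m : ℝ) ^ 2) := by
    field_simp; ring
  have hq' : 1 / (2 * (m : ℝ) ^ 2) ≤ 1 / (m : ℝ) ^ 2 := by
    rw [div_le_div_iff_of_pos_left one_pos (by positivity) (by positivity)]; nlinarith
  by_cases e0 : k 0 = k' 0 <;> by_cases e1 : k 1 = k' 1 <;> by_cases e2 : k 2 = k' 2
  · exact absurd (funext fun l => by fin_cases l <;> assumption) hkk
  · -- only coordinate 2 differs
    have hpar : (k 2 : ℕ) % 2 = (k' 2 : ℕ) % 2 := by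
      have e0' : (k 0 : ℕ) = k' 0 := congrArg Fin.val e0
      have e1' : (k 1 : ℕ) = k' 1 := congrArg Fin.val e1
      omega
    linarith [hpb 2 e2 hpar]
  · have hpar : (k 1 : ℕ) % 2 = (k' 1 : ℕ) % 2 := by
      have e0' : (k 0 : ℕ) = k' 0 := congrArg Fin.val e0
      have e2' : (k 2 : ℕ) = k' 2 := congrArg Fin.val e2
      omega
    linarith [hpb 1 e1 hpar]
  · linarith [hb 1 e1, hb 2 e2]
  · have hpar : (k 0 : ℕ) % 2 = (k' 0 : ℕ) % 2 := by
      have e1' : (k 1 : ℕ) = k' 1 := congrArg Fin.val e1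
      have e2' : (k 2 : ℕ) = k' 2 := congrArg Fin.val e2
      omega
    linarith [hpb 0 e0 hpar]
  · linarith [hb 0 e0, hb 2 e2]
  · linarith [hb 0 e0, hb 1 e1]
  · linarith [hb 0 e0, hb 1 e1]

/-- **FCC configurations.** If `n ≤ 4m³` there are `n` points of `𝕋³` at mutual squared
minimal-image distance `≥ 1/(2m²)`: the `D₃` points `k/(2m)`, `k₁ + k₂ + k₃` even, indexed by
`(a, b, c) ↦ (a, b, 2c + ((a+b) mod 2))`. -/
theorem exists_config_fcc {n m : ℕ} (hm : 0 < m) (hn : n ≤ 4 * m ^ 3) :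
    ∃ x : Fin n → T3, ∀ i j, i ≠ j → (1 : ℝ) / (2 * (m : ℝ) ^ 2) ≤ (Torus.euclidDist (x i) (x j)) ^ 2 := by
  classical
  let third : Fin (2 * m) → Fin (2 * m) → Fin m → Fin (2 * m) := fun a b c =>
    ⟨2 * (c : ℕ) + (((a : ℕ) + b) % 2), by have := c.isLt; omega⟩
  let idx : Fin (2 * m) × Fin (2 * m) × Fin m → Fin 3 → Fin (2 * m) := fun t =>
    ![t.1, t.2.1, third t.1 t.2.1 t.2.2]
  have h0 : ∀ t, idx t 0 = t.1 := fun t => rfl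
  have h1 : ∀ t, idx t 1 = t.2.1 := fun t => rfl
  have h2 : ∀ t, idx t 2 = third t.1 t.2.1 t.2.2 := fun t => rfl
  have h2v : ∀ t, (idx t 2 : ℕ) = 2 * (t.2.2 : ℕ) + (((t.1 : ℕ) + t.2.1) % 2) := fun t => rfl
  have hpar : ∀ t, 2 ∣ ((idx t 0 : ℕ) + (idx t 1 : ℕ) + (idx t 2 : ℕ)) := by
    intro t
    rw [h0, h1, h2v]
    omega
  have hinj : Function.Injective idx := by
    rintro ⟨a, b, c⟩ ⟨a', b', c'⟩ h
    have e0 := congrFun h 0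
    have e1 := congrFun h 1
    have e2 := congrArg Fin.val (congrFun h 2)
    rw [h0, h0] at e0
    rw [h1, h1] at e1
    rw [h2v, h2v] at e2
    simp only at e0 e1 e2
    subst e0; subst e1
    have : (c : ℕ) = c' := by omega
    rw [Fin.ext this]
  have hcard : Fintype.card (Fin n) ≤ Fintype.card (Fin (2 * m) × Fin (2 * m) × Fin m) := by
    simp only [Fintype.card_fin, Fintype.card_prod]
    calc n ≤ 4 * m ^ 3 := hn
      _ = 2 * m * (2 * m * m) := by ring
  obtain ⟨e⟩ := Function.Embedding.nonempty_of_card_le hcard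
  exact ⟨fun i => gridPoint (2 * m) (idx (e i)), fun i j hij =>
    gridPoint_dist_sq_of_even hm (fun h => hij (e.injective (hinj h))) (hpar _) (hpar _)⟩

/-- At reduced diameter `σ` with `σ⁶ < 2` (i.e. `σ³ < √2`, below close packing) and particle number
`N + 1 = 4m³`, the spheres of diameter `σ(N+1)^{-1/3}` fit into `𝕋³` with room to spare: an FCC
configuration has all mutual distances `> hsDiameter σ N` (`2m²σ² < r²`, `r³ = 4m³`, by comparing
cubes: `8m⁶σ⁶ < 16m⁶`). -/
theorem exists_config_hsDiameter_lt_fcc {σ : ℝ} (hσ6 : σ ^ 6 < 2) {N m : ℕ}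
    (hm : 0 < m) (hN : N + 1 = 4 * m ^ 3) :
    ∃ x : Fin (N + 1) → T3, ∀ i j, i ≠ j → hsDiameter σ N < Torus.euclidDist (x i) (x j) := by
  obtain ⟨x, hx⟩ := exists_config_fcc (n := N + 1) hm hN.le
  refine ⟨x, fun i j hij => ?_⟩
  have hd := hx i j hij
  set r : ℝ := ((N + 1 : ℕ) : ℝ) ^ (1 / 3 : ℝ) with hr
  have hN1 : (0 : ℝ) < ((N + 1 : ℕ) : ℝ) := by exact_mod_cast Nat.succ_pos N
  have hr0 : 0 < r := Real.rpow_pos_of_pos hN1 _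
  have h3 : r ^ (3 : ℕ) = ((N + 1 : ℕ) : ℝ) := by
    rw [hr, show (1 / 3 : ℝ) = ((3 : ℕ) : ℝ)⁻¹ by norm_num,
      Real.rpow_inv_natCast_pow hN1.le (by norm_num)]
  have hmR : (0 : ℝ) < m := by exact_mod_cast hm
  have h3' : r ^ 3 = 4 * (m : ℝ) ^ 3 := by rw [h3, hN]; push_cast; ring
  have hε : hsDiameter σ N = σ / r := by
    rw [hsDiameter, hr, Real.rpow_neg hN1.le]
    exact (div_eq_mul_inv σ _).symm
  -- `2 m² σ² < r²` by comparing cubes: `8 m⁶ σ⁶ < 16 m⁶ = r⁶`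
  have hcube : (2 * (m : ℝ) ^ 2 * σ ^ 2) ^ 3 < (r ^ 2) ^ 3 := by
    have : (r ^ 2) ^ 3 = 16 * (m : ℝ) ^ 6 := by
      rw [← pow_mul, show 2 * 3 = 3 * 2 by norm_num, pow_mul, h3']; ring
    rw [this]
    have hm6 : (0 : ℝ) < (m : ℝ) ^ 6 := by positivity
    nlinarith
  have hsq : 2 * (m : ℝ) ^ 2 * σ ^ 2 < r ^ 2 := lt_of_pow_lt_pow_left₀ 3 (by positivity) hcube
  have hquot : (σ / r) ^ 2 < 1 / (2 * (m : ℝ) ^ 2) := by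
    rw [div_pow, div_lt_div_iff₀ (by positivity) (by positivity)]
    linarith
  have hlt : (σ / r) ^ 2 < (Torus.euclidDist (x i) (x j)) ^ 2 := hquot.trans_le hd
  have hnn : 0 ≤ Torus.euclidDist (x i) (x j) := by rw [euclidDist_eq_sqrt]; exact Real.sqrt_nonneg _
  rw [hε]
  exact lt_of_pow_lt_pow_left₀ 2 hnn hlt

/-- The non-overlap set at `σ⁶ < 2`, `N + 1 = 4m³` has positive volume. -/
theorem volume_setOf_lt_euclidDist_pos_fcc {σ : ℝ} (hσ6 : σ ^ 6 < 2) {N m : ℕ}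
    (hm : 0 < m) (hN : N + 1 = 4 * m ^ 3) :
    0 < volume {x : Fin (N + 1) → T3 |
      ∀ i j, i ≠ j → hsDiameter σ N < Torus.euclidDist (x i) (x j)} :=
  (isOpen_setOf_lt_euclidDist _ _).measure_pos volume (exists_config_hsDiameter_lt_fcc hσ6 hm hN)

/-- The configurational partition function with activity `1` is positive at `σ⁶ < 2`,
`N + 1 = 4m³`. -/
theorem posPartition_one_pos_fcc {σ : ℝ} (hσ6 : σ ^ 6 < 2) {N m : ℕ}
    (hm : 0 < m) (hN : N + 1 = 4 * m ^ 3) :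
    0 < posPartition (fun _ : T3 => (1 : ℝ)) (hsDiameter σ N) (N + 1) := by
  have ha0' : ∀ _x : T3, (0 : ℝ) ≤ 1 := fun _ => zero_le_one
  rw [posPartition, integral_pos_iff_support_of_nonneg (fun x => posWeight_nonneg ha0' _ x)
    (integrable_posWeight continuous_const ha0' _ _)]
  refine lt_of_lt_of_le (volume_setOf_lt_euclidDist_pos_fcc hσ6 hm hN)
    (measure_mono fun x hx => ?_)
  rw [Function.mem_support, posWeight,
    Set.indicator_of_mem (show x ∈ posDomain (hsDiameter σ N) (N + 1) from
      fun i j hij => (hx i j hij).le)]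
  simp

/-- **The homogeneous local Gibbs law keeps full mass at `σ⁶ < 2` along `N + 1 = 4m³`.** -/
theorem localGibbsLaw_univ_fcc {σ : ℝ} (hσ6 : σ ^ 6 < 2) {N m : ℕ}
    (hm : 0 < m) (hN : N + 1 = 4 * m ^ 3)
    (Φ : HardSphereFlow (Torus.geometry (Fin 3)) (hsDiameter σ N) (N + 1)) :
    localGibbsLaw σ (fun _ => 1) (fun _ => 0) (fun _ => 1) N Φ univ = 1 := by
  have hP := posPartition_one_pos_fcc hσ6 hm hN
  rw [localGibbsLaw_eq, localGibbsMeasure_univ continuous_const continuous_const continuous_const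
    (fun _ => zero_le_one) (fun _ => one_pos) σ N, ← ENNReal.ofReal_mul (inv_nonneg.2 hP.le),
    inv_mul_cancel₀ hP.ne', ENNReal.ofReal_one]

end AprioriBoundsNegative

end Summit.AtomisticToContinuum.HydrodynamicLimit.Theorems

end
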